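import Literature.Analysis.FluidPDE.PressurePoisson
import Literature.Analysis.FluidPDE.WholeSpaceIBP
import Literature.Analysis.FluidPDE.SverakLandauTangential
import HarnessLib

/-!
# Šverák's classification of `(−1)`-homogeneous steady Navier–Stokes flows — divergence identities

Analysis/FluidPDE support file of the series `SverakLandau*` proving the named fact
`Literature.Analysis.FluidPDE.Sverak2011_landauClassification` (V. Šverák, J. Math. Sci. 179
(2011) = arXiv:math/0604550, Thm. 1).

Šverák, §4, after Lemma 1: the `f`-equation `−Δf − 2f + div(fv) = 2c` ((E2)) is integrated over
`S²` to get `c = 0`, and with `w = 2 − Δφ = 2 + f` the equation `−Δw + div(∇φ w) = 0` is solved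
("the solutions of this equation are well known: they are functions of the form `c₁e^φ`").  In
the `ℝ³ ∖ {0}` rendering integrals over `S²` become integrals over `ℝ³` against radial bumps
`χ(|x|)`, and "`∫_{S²} div_{S²}(…) = 0`" becomes `∫ χ(|x|) div W = 0` for fields `W` tangent to
spheres (tree: `integral_radial_mul_divergence`).  This file supplies the **pointwise divergence
identities** for the globally smooth regularised fields `U` (velocity), `R` (`= |x|⁻²`),
`F̃ = ⟪x, U⟫`, `Vt = U − F̃R x` (tangential part, `= ∇Φ̃`) on the open set where the relations
hold:

* `Sverak2011.fderiv_radial_self_on` (`⟪x, ∇F̃⟫ = 0`), `Sverak2011.inner_tangentialReg_on`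
  (`⟪x, Vt⟫ = 0`), `Sverak2011.divergence_tangentialReg_on` (`div Vt = −F̃R`, from `div U = 0`),
  `Sverak2011.divergence_smul_tangentialReg_on` (`div(F̃Vt) = ∑ Uₗ∂ₗF̃ − F̃²R`),
  `Sverak2011.divergence_gradient_eq_sum` (`div ∇F̃ = ∑ₗ ∂ₗ∂ₗF̃`);
* `Sverak2011.bernoulli_combination_on` — with the pressure-free `f`-equation
  `|x|²(−∑ₗ∂ₗ∂ₗF̃ + ∑ₗ Uₗ∂ₗF̃) = F̃² + 2F̃ + 2k₀` of `SverakLandauRadialVorticity`: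
  **`2k₀R = −div ∇F̃ + div(F̃Vt) + 2 div Vt`** (so `k₀ = 0` after integration, next file);
* `Sverak2011.divergence_conformalY_on`, `Sverak2011.inner_conformalY_on`,
  `Sverak2011.divergence_smul_conformalY_on` — for `Y = ∇F̃ − (2 + F̃)Vt` and
  `C = (2 + F̃)e^{−Φ̃}` (`∇Φ̃ = Vt`), once `k₀ = 0`: `div Y = 0`, `⟪x, Y⟫ = 0`,
  `div(C Y) = e^{−Φ̃}|Y|²` (the energy identity behind "`w = c₁e^φ`").

## References

* V. Šverák, *On Landau's solutions of the Navier–Stokes equations*, J. Math. Sci. 179 (2011)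
  208–228, arXiv:math/0604550, §4, (E2)–(E4). [`Sverak2011`]
-/

noncomputable section

open Set Filter Metric
open scoped Topology BigOperators ContDiff Laplacian RealInnerProductSpace

namespace Literature.Analysis.FluidPDE

namespace Sverak2011

variable {U Vt Y : EuclideanSpace ℝ (Fin 3) → EuclideanSpace ℝ (Fin 3)}
  {R F P Φ C : EuclideanSpace ℝ (Fin 3) → ℝ} {S : Set (EuclideanSpace ℝ (Fin 3))} {k₀ : ℝ}

/-- `Df(y) w = ∑ⱼ wⱼ ∂ⱼf(y)` and the radial profile: `⟪y, ∇F̃⟫ = DF̃(y) y = 0` on `S` for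
`F̃ = ⟪y, U⟫` with `U` satisfying Euler's relation (`F̃` is homogeneous of degree `0`). [folklore] -/
theorem fderiv_radial_self_on (hU : ContDiff ℝ ∞ U) (hEu : ∀ y ∈ S, fderiv ℝ U y y = -U y)
    (hF : F = fun y => ∑ i, y i * U y i) {y : EuclideanSpace ℝ (Fin 3)} (hy : y ∈ S) :
    fderiv ℝ F y y = 0 := by
  rw [fderiv_apply_eq_sum_mul_pderiv, hF]
  simp only [pderiv_radial hU]
  have hE : ∀ i, ∑ j, y j * pderiv j (fun z => U z i) y = -1 * U y i := fun i =>
    sum_mul_pderiv_comp_eq ((hU.differentiable (by simp)) y) (by rw [hEu y hy, neg_one_smul]) i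
  simp only [mul_add, Finset.sum_add_distrib, Finset.mul_sum]
  rw [Finset.sum_comm]
  have : ∑ i, ∑ l, y l * (y i * pderiv l (fun z => U z i) y) = ∑ i, y i * (-1 * U y i) := by
    refine Finset.sum_congr rfl fun i _ => ?_
    rw [← hE i, Finset.mul_sum]
    exact Finset.sum_congr rfl fun l _ => by ring
  rw [this, ← Finset.sum_add_distrib]
  exact Finset.sum_eq_zero fun i _ => by ring

/-- `DR(y) y = −2R(y)` on `S` when `R|y|² = 1` there. [folklore] -/
theorem fderiv_invNormSq_self_on (hR : ContDiff ℝ ∞ R) (hS : IsOpen S)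
    (hR1 : ∀ y ∈ S, R y * ∑ i, y i ^ 2 = 1) {y : EuclideanSpace ℝ (Fin 3)} (hy : y ∈ S) :
    fderiv ℝ R y y = -2 * R y := by
  rw [fderiv_apply_eq_sum_mul_pderiv]
  simp only [pderiv_invNormSq_on hR hS hR1 hy]
  have h1 := hR1 y hy
  have : ∑ j, y j * (-2 * y j * R y ^ 2) = -2 * R y * (R y * ∑ i, y i ^ 2) := by
    rw [Finset.mul_sum, Finset.mul_sum]
    exact Finset.sum_congr rfl fun j _ => by ring
  rw [this, h1, mul_one]

/-- The regularised tangential field is tangent to spheres: `⟪y, Vt y⟫ = 0` on `S`. [folklore] -/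
theorem inner_tangentialReg_on (hR1 : ∀ y ∈ S, R y * ∑ i, y i ^ 2 = 1)
    (hF : F = fun y => ∑ i, y i * U y i) (hV : Vt = fun y => U y - (F y * R y) • y)
    {y : EuclideanSpace ℝ (Fin 3)} (hy : y ∈ S) : ⟪y, Vt y⟫ = 0 := by
  have h1 := hR1 y hy
  have e1 : ⟪y, U y⟫ = F y := by
    rw [hF]; simp only [PiLp.inner_apply, RCLike.inner_apply, conj_trivial]
    exact Finset.sum_congr rfl fun j _ => mul_comm _ _
  rw [hV]; beta_reduce
  rw [inner_sub_right, inner_smul_right, real_inner_self_eq_norm_sq,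
    EuclideanSpace.real_norm_sq_eq, e1, mul_assoc, h1, mul_one, sub_self]

/-- The divergence of the identity field of `ℝ³` is `3`. [folklore] -/
theorem divergence_id_three (y : EuclideanSpace ℝ (Fin 3)) :
    VectorCalculus.divergence (fun x : EuclideanSpace ℝ (Fin 3) => x) y = 3 := by
  rw [VectorCalculus.divergence, fderiv_fun_id]
  have := LinearMap.trace_id ℝ (EuclideanSpace ℝ (Fin 3))
  rw [finrank_euclideanSpace_fin] at this
  exact_mod_cast this

/-- **`div Vt = −F̃R` on `S`** (`div U = 0`, `⟪y, ∇F̃⟫ = 0`, `DR(y)y = −2R`, `div id = 3`): the bulk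
form of the third equation `div v + f = 0` of Šverák's sphere system (S). [cite: Sverak2011, §4 (S)] -/
theorem divergence_tangentialReg_on (hU : ContDiff ℝ ∞ U) (hR : ContDiff ℝ ∞ R) (hS : IsOpen S)
    (hEu : ∀ y ∈ S, fderiv ℝ U y y = -U y)
    (hdivU : ∀ y ∈ S, VectorCalculus.divergence U y = 0)
    (hR1 : ∀ y ∈ S, R y * ∑ i, y i ^ 2 = 1)
    (hF : F = fun y => ∑ i, y i * U y i) (hV : Vt = fun y => U y - (F y * R y) • y)
    {y : EuclideanSpace ℝ (Fin 3)} (hy : y ∈ S) :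
    VectorCalculus.divergence Vt y = -(F y * R y) := by
  have hFd : Differentiable ℝ F := hF ▸ differentiable_radial hU
  have hRd : Differentiable ℝ R := hR.differentiable (by simp)
  have hFR : DifferentiableAt ℝ (fun y => F y * R y) y := (hFd y).mul (hRd y)
  have hFRs : DifferentiableAt ℝ (fun y : EuclideanSpace ℝ (Fin 3) => (F y * R y) • y) y :=
    hFR.smul differentiableAt_id
  rw [hV, divergence_sub_apply ((hU.differentiable (by simp)) y) hFRs,
    hdivU y hy, divergence_smul_apply (u := fun y => y) hFR differentiableAt_id, divergence_id_three,
    zero_sub]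
  -- `⟪y, ∇(F̃R)⟫ = D(F̃R)(y) y = F̃ DR y + R DF̃ y = −2F̃R`
  have hg : ⟪y, gradient (fun y => F y * R y) y⟫ = fderiv ℝ (fun y => F y * R y) y y := by
    rw [real_inner_comm, inner_gradient_left]
  rw [hg, fderiv_fun_mul (hFd y) (hRd y)]
  simp only [FunLike.coe_add, FunLike.coe_smul, Pi.add_apply, Pi.smul_apply,
    smul_eq_mul, fderiv_radial_self_on hU hEu hF hy, fderiv_invNormSq_self_on hR hS hR1 hy]
  ring

/-- **`div(F̃Vt) = ∑ₗ Uₗ∂ₗF̃ − F̃²R` on `S`** (`div(F̃Vt) = F̃ div Vt + ⟪Vt, ∇F̃⟫`,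
`⟪Vt, ∇F̃⟫ = DF̃(U) − F̃R DF̃(y) = ∑ Uₗ∂ₗF̃`). [folklore] -/
theorem divergence_smul_tangentialReg_on (hU : ContDiff ℝ ∞ U) (hR : ContDiff ℝ ∞ R)
    (hS : IsOpen S) (hEu : ∀ y ∈ S, fderiv ℝ U y y = -U y)
    (hdivU : ∀ y ∈ S, VectorCalculus.divergence U y = 0)
    (hR1 : ∀ y ∈ S, R y * ∑ i, y i ^ 2 = 1)
    (hF : F = fun y => ∑ i, y i * U y i) (hV : Vt = fun y => U y - (F y * R y) • y)
    {y : EuclideanSpace ℝ (Fin 3)} (hy : y ∈ S) :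
    VectorCalculus.divergence (fun y => F y • Vt y) y =
      ∑ l, U y l * pderiv l F y - F y ^ 2 * R y := by
  have hFd : Differentiable ℝ F := hF ▸ differentiable_radial hU
  have hRd : Differentiable ℝ R := hR.differentiable (by simp)
  have hVd : DifferentiableAt ℝ Vt y := by
    rw [hV]; exact ((hU.differentiable (by simp)) y).sub (((hFd y).mul (hRd y)).smul
      differentiableAt_id)
  rw [divergence_smul_apply (hFd y) hVd, divergence_tangentialReg_on hU hR hS hEu hdivU hR1 hF hV hy,
    real_inner_comm, inner_gradient_left]
  have hVy : Vt y = U y - (F y * R y) • y := by rw [hV]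
  rw [hVy, map_sub, map_smul, fderiv_radial_self_on hU hEu hF hy, smul_zero, sub_zero,
    fderiv_apply_eq_sum_mul_pderiv]
  ring

/-- `div ∇f = ∑ₗ ∂ₗ∂ₗf` for smooth `f` (the Laplacian in coordinates, via the tree's
`divergence_eq_sum_pderiv` and `gradient_apply_comp`). [folklore] -/
theorem divergence_gradient_eq_sum (hF : ContDiff ℝ ∞ F) (y : EuclideanSpace ℝ (Fin 3)) :
    VectorCalculus.divergence (gradient F) y = ∑ l, pderiv l (pderiv l F) y := by
  have hgd : DifferentiableAt ℝ (gradient F) y :=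
    ((InnerProductSpace.toDual ℝ (EuclideanSpace ℝ (Fin 3))).symm.contDiff.comp
      (hF.fderiv_right (m := 1) (by norm_cast))).differentiable one_ne_zero y
  rw [divergence_eq_sum_pderiv hgd]
  refine Finset.sum_congr rfl fun l _ => ?_
  have : (fun z => gradient F z l) = pderiv l F := funext fun z => gradient_apply_comp F z l
  rw [this]

/-- **The combination integrated in print** (Šverák's (E2) `−Δf − 2f + div(fv) = 2c` against `1`
over `S²`).  If on `S` the pressure-free `f`-equation
`|y|²(−∑ₗ∂ₗ∂ₗF̃ + ∑ₗ Uₗ∂ₗF̃) = F̃² + 2F̃ + 2k₀` holds together with the relations of this file, then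
`2k₀ R = −div ∇F̃ + div(F̃Vt) + 2 div Vt` on `S` — a combination of divergences of fields tangent
to spheres. [cite: Sverak2011, §4 (E2)] -/
theorem bernoulli_combination_on (hU : ContDiff ℝ ∞ U) (hR : ContDiff ℝ ∞ R) (hS : IsOpen S)
    (hEu : ∀ y ∈ S, fderiv ℝ U y y = -U y)
    (hdivU : ∀ y ∈ S, VectorCalculus.divergence U y = 0)
    (hR1 : ∀ y ∈ S, R y * ∑ i, y i ^ 2 = 1)
    (hF : F = fun y => ∑ i, y i * U y i) (hV : Vt = fun y => U y - (F y * R y) • y)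
    (hFeq : ∀ y ∈ S, (∑ i, y i ^ 2) * (-∑ l, pderiv l (pderiv l F) y +
      ∑ l, U y l * pderiv l F y) = F y ^ 2 + 2 * F y + 2 * k₀)
    {y : EuclideanSpace ℝ (Fin 3)} (hy : y ∈ S) :
    2 * k₀ * R y = -VectorCalculus.divergence (gradient F) y +
      VectorCalculus.divergence (fun y => F y • Vt y) y + 2 * VectorCalculus.divergence Vt y := by
  have hFc : ContDiff ℝ ∞ F := hF ▸ contDiff_radial hU
  rw [divergence_gradient_eq_sum hFc, divergence_smul_tangentialReg_on hU hR hS hEu hdivU hR1 hF hV hy,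
    divergence_tangentialReg_on hU hR hS hEu hdivU hR1 hF hV hy]
  have h1 := hR1 y hy
  have h2 := congrArg (fun t => R y * t) (hFeq y hy)
  simp only at h2
  rw [← mul_assoc, h1, one_mul] at h2
  linarith

/-! ### The conformal fields `Y = ∇F̃ − (2 + F̃)Vt`, `C = (2 + F̃)e^{−Φ̃}` -/

/-- **`div Y = 0` on `S`** for `Y = ∇F̃ − (2 + F̃)Vt`, once `k₀ = 0` (the bulk form of Šverák's
`−Δw + div(∇φ w) = 0`, `w = 2 + f`). [cite: Sverak2011, §4 (E3)] -/
theorem divergence_conformalY_on (hU : ContDiff ℝ ∞ U) (hR : ContDiff ℝ ∞ R) (hS : IsOpen S)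
    (hEu : ∀ y ∈ S, fderiv ℝ U y y = -U y)
    (hdivU : ∀ y ∈ S, VectorCalculus.divergence U y = 0)
    (hR1 : ∀ y ∈ S, R y * ∑ i, y i ^ 2 = 1)
    (hF : F = fun y => ∑ i, y i * U y i) (hV : Vt = fun y => U y - (F y * R y) • y)
    (hFeq : ∀ y ∈ S, (∑ i, y i ^ 2) * (-∑ l, pderiv l (pderiv l F) y +
      ∑ l, U y l * pderiv l F y) = F y ^ 2 + 2 * F y + 2 * 0)
    (hY : Y = fun y => gradient F y - (2 + F y) • Vt y)
    {y : EuclideanSpace ℝ (Fin 3)} (hy : y ∈ S) : VectorCalculus.divergence Y y = 0 := by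
  have hFc : ContDiff ℝ ∞ F := hF ▸ contDiff_radial hU
  have hFd : Differentiable ℝ F := hFc.differentiable (by simp)
  have hRd : Differentiable ℝ R := hR.differentiable (by simp)
  have hVd : DifferentiableAt ℝ Vt y := by
    rw [hV]; exact ((hU.differentiable (by simp)) y).sub (((hFd y).mul (hRd y)).smul
      differentiableAt_id)
  have hgd : DifferentiableAt ℝ (gradient F) y :=
    ((InnerProductSpace.toDual ℝ (EuclideanSpace ℝ (Fin 3))).symm.contDiff.comp
      (hFc.fderiv_right (m := 1) (by norm_cast))).differentiable one_ne_zero y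
  have hW : DifferentiableAt ℝ (fun y => 2 + F y) y := (hFd y).const_add 2
  have hWV : DifferentiableAt ℝ (fun y => (2 + F y) • Vt y) y := hW.smul hVd
  rw [hY, divergence_sub_apply hgd hWV, divergence_gradient_eq_sum hFc,
    divergence_smul_apply (θ := fun y => 2 + F y) (u := Vt) hW hVd,
    divergence_tangentialReg_on hU hR hS hEu hdivU hR1 hF hV hy,
    real_inner_comm, inner_gradient_left]
  have hVy : Vt y = U y - (F y * R y) • y := by rw [hV]
  rw [fderiv_const_add, hVy, map_sub, map_smul, fderiv_radial_self_on hU hEu hF hy, smul_zero,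
    sub_zero, fderiv_apply_eq_sum_mul_pderiv]
  have h1 := hR1 y hy
  have h2 := congrArg (fun t => R y * t) (hFeq y hy)
  simp only at h2
  rw [← mul_assoc, h1, one_mul] at h2
  nlinarith [h2]

/-- `Y = ∇F̃ − (2 + F̃)Vt` is tangent to spheres on `S`: `⟪y, Y y⟫ = 0`. [folklore] -/
theorem inner_conformalY_on (hU : ContDiff ℝ ∞ U) (hEu : ∀ y ∈ S, fderiv ℝ U y y = -U y)
    (hR1 : ∀ y ∈ S, R y * ∑ i, y i ^ 2 = 1)
    (hF : F = fun y => ∑ i, y i * U y i) (hV : Vt = fun y => U y - (F y * R y) • y)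
    (hY : Y = fun y => gradient F y - (2 + F y) • Vt y)
    {y : EuclideanSpace ℝ (Fin 3)} (hy : y ∈ S) : ⟪y, Y y⟫ = 0 := by
  rw [hY]; beta_reduce
  rw [inner_sub_right, inner_smul_right, inner_tangentialReg_on hR1 hF hV hy, mul_zero, sub_zero,
    real_inner_comm, inner_gradient_left, fderiv_radial_self_on hU hEu hF hy]

/-- **The energy identity** `div(C Y) = e^{−Φ̃}|Y|²` on `S` for `C = (2 + F̃)e^{−Φ̃}` with
`∇Φ̃ = Vt` and `div Y = 0` (Šverák: "write `w` in the form `c₁(x)e^{φ(x)}`. We get an equation for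
`c₁` …"). [cite: Sverak2011, §4 (E3)–(E4)] -/
theorem divergence_smul_conformalY_on (hU : ContDiff ℝ ∞ U) (hR : ContDiff ℝ ∞ R)
    (hΦ : ContDiff ℝ ∞ Φ) (hS : IsOpen S)
    (hEu : ∀ y ∈ S, fderiv ℝ U y y = -U y)
    (hdivU : ∀ y ∈ S, VectorCalculus.divergence U y = 0)
    (hR1 : ∀ y ∈ S, R y * ∑ i, y i ^ 2 = 1)
    (hF : F = fun y => ∑ i, y i * U y i) (hV : Vt = fun y => U y - (F y * R y) • y)
    (hFeq : ∀ y ∈ S, (∑ i, y i ^ 2) * (-∑ l, pderiv l (pderiv l F) y +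
      ∑ l, U y l * pderiv l F y) = F y ^ 2 + 2 * F y + 2 * 0)
    (hgradΦ : ∀ y ∈ S, gradient Φ y = Vt y)
    (hY : Y = fun y => gradient F y - (2 + F y) • Vt y)
    (hC : C = fun y => (2 + F y) * Real.exp (-Φ y))
    {y : EuclideanSpace ℝ (Fin 3)} (hy : y ∈ S) :
    VectorCalculus.divergence (fun y => C y • Y y) y = Real.exp (-Φ y) * ‖Y y‖ ^ 2 := by
  have hFc : ContDiff ℝ ∞ F := hF ▸ contDiff_radial hU
  have hFd : Differentiable ℝ F := hFc.differentiable (by simp)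
  have hRd : Differentiable ℝ R := hR.differentiable (by simp)
  have hΦd : Differentiable ℝ Φ := hΦ.differentiable (by simp)
  have hVd : DifferentiableAt ℝ Vt y := by
    rw [hV]; exact ((hU.differentiable (by simp)) y).sub (((hFd y).mul (hRd y)).smul
      differentiableAt_id)
  have hgd : DifferentiableAt ℝ (gradient F) y :=
    ((InnerProductSpace.toDual ℝ (EuclideanSpace ℝ (Fin 3))).symm.contDiff.comp
      (hFc.fderiv_right (m := 1) (by norm_cast))).differentiable one_ne_zero y
  have hYd : DifferentiableAt ℝ Y y := by
    rw [hY]; exact hgd.sub (((hFd y).const_add 2).smul hVd)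
  have hE : DifferentiableAt ℝ (fun y => Real.exp (-Φ y)) y := (hΦd y).neg.exp
  have hCd : DifferentiableAt ℝ C y := by rw [hC]; exact ((hFd y).const_add 2).mul hE
  rw [divergence_smul_apply hCd hYd,
    divergence_conformalY_on hU hR hS hEu hdivU hR1 hF hV hFeq hY hy, mul_zero, zero_add,
    real_inner_comm, inner_gradient_left, hC,
    fderiv_fun_mul ((hFd y).const_add 2) hE, fderiv_const_add,
    fderiv_exp (f := fun y => -Φ y) (hΦd y).neg, fderiv_fun_neg]
  simp only [FunLike.coe_add, FunLike.coe_smul, FunLike.coe_neg, Pi.add_apply, Pi.smul_apply,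
    Pi.neg_apply, smul_eq_mul]
  -- `DF̃(Y) = ⟪∇F̃, Y⟫`, `DΦ̃(Y) = ⟪Ṽ, Y⟫`
  have e1 : fderiv ℝ F y (Y y) = ⟪gradient F y, Y y⟫ := (inner_gradient_left).symm
  have e2 : fderiv ℝ Φ y (Y y) = ⟪Vt y, Y y⟫ := by
    rw [← hgradΦ y hy]; exact (inner_gradient_left).symm
  have hYy : Y y = gradient F y - (2 + F y) • Vt y := by rw [hY]
  rw [e1, e2, hYy, ← real_inner_self_eq_norm_sq]
  simp only [inner_sub_left, inner_sub_right, inner_smul_left, inner_smul_right, RCLike.conj_to_real]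
  rw [real_inner_comm (Vt y) (gradient F y)]
  ring

end Sverak2011

end Literature.Analysis.FluidPDE
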